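import Summits.QuantumFields.BalabanUV.Beta.EriceRemainderEnclosureHistoryAutonomyComparisonAgeCompositionOldRegularity

/-!
# EriceRemainderEnclosureHistoryAutonomyComparisonAgeCompositionYoungMass — (E115f) route (N), first order: THE YOUNG TOTAL MASS BELOW A PIN, AND THE ASSEMBLED
# KEY-FREE COMPOSITION STEP ALONG EVERY FLOW.  (R2) of README `HOME/b2b-balaban-beta-d4-p2/g96/README.md` §3: along every box solution of an isotone memory with
# floor `b > 0` the coupling drops by at least `(b∕2)·h_{j+1}³` per scale (convexity of `a ↦ a^{−1∕2}`: **`drop_ge_floor_mul_cube`**), so the TOTAL MASS OF A YOUNG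
# AGE BELOW A PIN telescopes: `Σ_{m>n} y·L_yh_{m+y}³∕2 ≤ y·L_y·h_{n+y}∕b` (**`young_total_mass_le`**).  With (E115d) `sol_ge_first_sub_reads`, (E115b)
# `flow_young_surplus_ge_local'` ∕ `young_kernel_facts` and the row induction's `0 ≤ ε ≤ 1` below the pin, this gives THE ASSEMBLED STEP
# (**`flow_keyfree_step`**): for a young age `y` below a set `O` of older ages (old kernel = the tail-sum of their undamped lone kernels, with the END at every
# truncation for its solution operator — the INDUCTION HYPOTHESIS) and `0 ≤ ε ≤ 1` strictly below the pin (the ROW induction), the full first-order surplus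
# at the pin `n` satisfies
#   `ε n ≥ (1 − x̃)·v n − x̃·Inc_D v(n) − x̃^D·(v(n+Dy) + Var_{≥n+Dy} v) − 4·F_O(n)·(y·L_y·h_{n+y}∕b)∕(1 − x̃)`,
# `v = S_O 1_{[0,J]}`, `x̃ = y·L_yh_{n+y}³∕2 ≤ √2∕2`, `F_O(n) = Σ_{o∈O} L_oh_{n+o}³∕2` — EVERY term on the right is data of the OLD system and of the flow.  So the
# every-range END follows by induction over the ages from ONE property of old surpluses: the relative smallness of `Inc_D v` and of `F_O` against `v n`
# (README §6 (1): proved for a lone old age in (E115e); open for several).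

Cell `pub-balaban`, β-function sub-cell, BINDER row D4 «RemainderConst leaves for Bałaban's split» (`HOME/BINDER-OWNERS.md`; owner lineage `b2b-balaban-beta-an4`;
this file by co-owner #2 lineage `b2b-balaban-beta-d4-p2`, generation 96), β-FLOW TEAM duty (1), FREEZE (0) honoured (def-free; imports (E115e); uses (E115c)
`sol_ge_first_sub_var`, (E115d) `var_read_le` (applied to the young reads CUT at the pin, so that only `0 ≤ ε` BELOW the pin is needed — (E115d)'s
`sol_ge_first_sub_reads` asks `0 ≤ R_y ε` everywhere, too much for the row induction), (E115b) `young_kernel_facts` ∕ `young_indicator_sol_bounds` ∕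
`sol_ge_local'`, (E48a) `strictAnti_of_memFlow` BY NAME; the display of `KL` is (E80a)'s with `g ≡ 1`; the old set `O` is a `Finset ℕ`; nothing restated).

HONEST FRAMING (page 1, verbatim and binding).  *"Discharging BetaPertH makes Bałaban's UV stability UNCONDITIONAL — a real constructive-QFT result; it is
NOT the continuum limit and NOT the Clay problem."*  THIS FILE DISCHARGES NOTHING OF THE KIND.  Elementary real analysis about ABSTRACT functionals on a box
]0,γ]^ℕ with displayed floors, profiles and signs, and the FIRST-ORDER renewal objects of route (N) built from them — hypotheses of a census, not facts; the
form, signs, ages and moments of Bałaban's (1.22) limit functional are NOT PRINTED ([I] p. 298; GAPS G-t4-U2-1∕-2) and NOT asserted.  Row D4 class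
UNCHANGED (critical-path width 0; instance 0∕1; D4 DISCHARGE NO DATE).  HONEST DEPENDENCY: continuum YM on T⁴ ⇐ BetaPertH ∧ nine spine estimates (0/9
proved); BetaPertH ⇐ (D1) ∧ (D4) ∧ CAP+tail; G-an2-4 gates asym, D1 and NE2/3/4.

NOT CLAIMED: the END for `O ∪ {y}` (the right-hand side must still be shown non-negative: README §6 (1)); anything printed — NOT B12 Thm 2, NOT BetaPertH.

WHAT IS PROVED ([folklore]; 0 `def`, 0 sorry).  §1 `half_inv_sq_sub_mul_cube_le`, **`drop_ge_floor_mul_cube`**, **`young_total_mass_le`**.  §2 `old_kernel_facts`,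
**`flow_keyfree_step`**.
-/
noncomputable section
open Finset

namespace Summit.QuantumFields.BalabanUV.Beta.EriceRemainderEnclosureHistoryAutonomyComparisonAgeCompositionYoungMass

open Literature.MathematicalPhysics.QuantumFieldTheory.Balaban1983to89
open Literature.MathematicalPhysics.QuantumFieldTheory.Balaban1983to89.T4BetaStationary
open Literature.MathematicalPhysics.QuantumFieldTheory.Balaban1983to89.T4BetaFlowWellPosed
open Summit.QuantumFields.BalabanUV.Beta.EriceRemainderEnclosureHistoryAutonomyComparisonAgeCompositionBVStabilityFlow
  (young_kernel_facts young_indicator_sol_bounds sol_ge_local')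
open Summit.QuantumFields.BalabanUV.Beta.EriceRemainderEnclosureHistoryAutonomyComparisonAgeCompositionKeyFree (sol_ge_first_sub_var)
open Summit.QuantumFields.BalabanUV.Beta.EriceRemainderEnclosureHistoryAutonomyComparisonAgeCompositionReadVariation (var_read_le)
open Summit.QuantumFields.BalabanUV.Beta.EriceRemainderEnclosureHistoryAutonomyOrder (strictAnti_of_memFlow)

variable {B : (ℕ → ℝ) → ℝ} {γ b gIR : ℝ} {L : ℕ → ℝ} {K : ℕ} {h : ℕ → ℝ}

/-! ## §1 The drop per scale and the young total mass -/

/-- Convexity of `a ↦ a^{−1∕2}` in elementary form: `0 < q ≤ p` ⟹ `½·(1∕q² − 1∕p²)·q³ ≤ p − q`. [folklore] -/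
theorem half_inv_sq_sub_mul_cube_le {p q : ℝ} (hq : 0 < q) (hqp : q ≤ p) : 1 / 2 * (1 / q ^ 2 - 1 / p ^ 2) * q ^ 3 ≤ p - q := by
  have hp : 0 < p := lt_of_lt_of_le hq hqp
  have e : 1 / 2 * (1 / q ^ 2 - 1 / p ^ 2) * q ^ 3 = q * (p - q) * (p + q) / (2 * p ^ 2) := by
    field_simp; ring
  rw [e, div_le_iff₀ (by positivity)]
  nlinarith [mul_nonneg (sub_nonneg.mpr hqp) (mul_nonneg hq.le (sub_nonneg.mpr hqp)), mul_nonneg (sub_nonneg.mpr hqp) hp.le]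

/-- **THE DROP PER SCALE.**  Along a box solution of a memory with floor `b`: `(b∕2)·h_{j+1}³ ≤ h_j − h_{j+1}`. [folklore] -/
theorem drop_ge_floor_mul_cube (hb : 0 < b) (hlo : ∀ u, SeqBox γ u → b ≤ B u) (hh : SeqBox γ h) (hf : MemFlow B gIR h) (j : ℕ) :
    b / 2 * h (j + 1) ^ 3 ≤ h j - h (j + 1) := by
  have hq : 0 < h (j + 1) := (hh (j + 1)).1
  have hp : 0 < h j := (hh j).1
  have hanti := (strictAnti_of_memFlow hb hlo hh hf).antitone
  have hqp : h (j + 1) ≤ h j := hanti (Nat.le_succ j)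
  have hstep : 1 / h (j + 1) ^ 2 - 1 / h j ^ 2 = B (fun i => h (j + 1 + i)) := by rw [hf.2 j]; ring
  have hB : b ≤ 1 / h (j + 1) ^ 2 - 1 / h j ^ 2 := by rw [hstep]; exact hlo _ (fun i => hh (j + 1 + i))
  have hc := half_inv_sq_sub_mul_cube_le hq hqp
  have : b / 2 * h (j + 1) ^ 3 ≤ 1 / 2 * (1 / h (j + 1) ^ 2 - 1 / h j ^ 2) * h (j + 1) ^ 3 := by
    have h3 : 0 ≤ h (j + 1) ^ 3 := by positivity
    nlinarith
  linarith

/-- **THE YOUNG TOTAL MASS BELOW A PIN.**  `Σ_{m∈(n, M)} y·L_yh_{m+y}³∕2 ≤ y·L_y·h_{n+y}∕b` for every `M` (telescoping of the drops; `L_y ≥ 0`). [folklore] -/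
theorem young_total_mass_le (hL : ∀ k, 0 ≤ L k) (hb : 0 < b) (hlo : ∀ u, SeqBox γ u → b ≤ B u) (hh : SeqBox γ h) (hf : MemFlow B gIR h)
    (y n M : ℕ) : ∑ m ∈ Ico (n + 1) M, (y : ℝ) * (L y * h (m + y) ^ 3 / 2) ≤ (y : ℝ) * L y * h (n + y) / b := by
  have hpos : ∀ j, 0 < h j := fun j => (hh j).1
  -- each term ≤ (y L_y / b)·(h(m+y−1) − h(m+y))
  have hterm : ∀ m ∈ Ico (n + 1) M, (y : ℝ) * (L y * h (m + y) ^ 3 / 2) ≤ (y : ℝ) * L y / b * (h (m + y - 1) - h (m + y)) := by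
    intro m hm
    have hm1 : 1 ≤ m := by have := (mem_Ico.mp hm).1; omega
    have hd := drop_ge_floor_mul_cube hb hlo hh hf (m + y - 1)
    rw [show m + y - 1 + 1 = m + y by omega] at hd
    have hyL : 0 ≤ (y : ℝ) * L y := mul_nonneg (Nat.cast_nonneg y) (hL y)
    have e : (y : ℝ) * (L y * h (m + y) ^ 3 / 2) = (y : ℝ) * L y / b * (b / 2 * h (m + y) ^ 3) := by field_simp
    rw [e]
    exact mul_le_mul_of_nonneg_left hd (div_nonneg hyL hb.le)
  refine (sum_le_sum hterm).trans ?_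
  rw [← mul_sum]
  have htel : ∑ m ∈ Ico (n + 1) M, (h (m + y - 1) - h (m + y)) ≤ h (n + y) := by
    by_cases hM : n + 1 ≤ M
    · have key : ∀ M', ∑ m ∈ Ico (n + 1) (n + 1 + M'), (h (m + y - 1) - h (m + y)) = h (n + y) - h (n + M' + y) := by
        intro M'
        induction M' with
        | zero => simp
        | succ M' ih =>
          rw [show n + 1 + (M' + 1) = n + 1 + M' + 1 by ring, sum_Ico_succ_top (by omega), ih,
            show n + 1 + M' + y - 1 = n + M' + y by omega, show n + 1 + M' + y = n + (M' + 1) + y by ring]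
          ring
      obtain ⟨M', rfl⟩ : ∃ M', M = n + 1 + M' := ⟨M - (n + 1), by omega⟩
      rw [key M']
      linarith [(hpos (n + M' + y)).le]
    · rw [Ico_eq_empty (by omega), sum_empty]; exact (hpos _).le
  have hyLb : 0 ≤ (y : ℝ) * L y / b := div_nonneg (mul_nonneg (Nat.cast_nonneg y) (hL y)) hb.le
  calc (y : ℝ) * L y / b * ∑ m ∈ Ico (n + 1) M, (h (m + y - 1) - h (m + y)) ≤ (y : ℝ) * L y / b * h (n + y) :=
        mul_le_mul_of_nonneg_left htel hyLb
    _ = (y : ℝ) * L y * h (n + y) / b := by ring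

/-! ## §2 The assembled KEY-free composition step along the flow -/

/-- **THE OLD KERNEL'S FACTS.**  For a set `O` of ages the weights `wO k m = [k ∈ O]·L_kh_{m+k}³∕2` are non-negative and non-increasing in the row, and their
first entry at the pin is `F_O(n) = Σ_{k∈[1,K), k∈O} L_kh_{n+k}³∕2`. [folklore] -/
theorem old_kernel_facts (hL : ∀ k, 0 ≤ L k) (hb : 0 < b) (hlo : ∀ u, SeqBox γ u → b ≤ B u) (hh : SeqBox γ h) (hf : MemFlow B gIR h)
    (O : Finset ℕ) {wO : ℕ → ℕ → ℝ} (hwO : ∀ k m, wO k m = if k ∈ O then L k * h (m + k) ^ 3 / 2 else 0) :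
    (∀ k m, 0 ≤ wO k m) ∧ (∀ k m, wO k (m + 1) ≤ wO k m) := by
  have hpos : ∀ j, 0 < h j := fun j => (hh j).1
  have hanti := (strictAnti_of_memFlow hb hlo hh hf).antitone
  refine ⟨fun k m => ?_, fun k m => ?_⟩
  · rw [hwO]; split_ifs
    · have := hL k; have := hpos (m + k); positivity
    · exact le_rfl
  · rw [hwO, hwO]; split_ifs
    · have h1 : h (m + 1 + k) ≤ h (m + k) := hanti (by omega)
      have h2 := pow_le_pow_left₀ (le_of_lt (hpos (m + 1 + k))) h1 3
      have := hL k; nlinarith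
    · exact le_rfl

/-- **THE ASSEMBLED KEY-FREE COMPOSITION STEP (every admissible flow, undamped, every pin, every truncation).**  `B` an isotone memory with floor `b > 0`
dominating `L ≥ 0` on the ages `< K`; `h` a box solution; a young age `1 ≤ y < K` with undamped lone kernel `KL y` (reads `Ry`, zero-tailed solution
operator `Sy`); a set `O` of OLD ages with the tail-sum kernel `KO m l = Σ_{k∈(l,K)} [k∈O]·L_kh_{m+k}³∕2` (reads `RO`, solution operator `SO`) whose indicator
solutions lie in `[0,1]` (THE INDUCTION HYPOTHESIS: the END for `O` at every truncation); the excess `e = 1_{[0,J]}`, `J ≤ N`; `ε` the zero-tailed full surplus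
(`ε = e − RO ε − Ry ε`) with `0 ≤ ε ≤ 1` STRICTLY BELOW the pin `n` (the row induction); `v = SO e`; `D` windows; `x̃ = y·L_yh_{n+y}³∕2`;
`F = Σ_{k∈[1,K)} [k∈O]·L_kh_{n+k}³∕2`.  THEN
`ε n ≥ (1 − x̃)·v n − x̃·Σ_{n≤m<n+Dy} max (v (m+1) − v m) 0 − x̃^D·(v (n+Dy) + Σ_{m≥n+Dy} |v m − v (m+1)|) − 4·F·(y·L_y·h_{n+y}∕b) ∕ (1 − x̃)`.
[folklore] -/
theorem flow_keyfree_step (hmono : ∀ u v : ℕ → ℝ, SeqBox γ u → SeqBox γ v → (∀ j, u j ≤ v j) → B u ≤ B v)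
    (hL : ∀ k, 0 ≤ L k) (hb : 0 < b) (hlo : ∀ u, SeqBox γ u → b ≤ B u) (hdom : ∀ u, SeqBox γ u → ∑ k ∈ range K, L k * u k ≤ B u)
    (hh : SeqBox γ h) (hf : MemFlow B gIR h) {y : ℕ} (hy : 1 ≤ y) (hyK : y < K) {N : ℕ}
    {KL : ℕ → ℕ → ℕ → ℝ} (hKL : ∀ k n l, KL k n l = if 0 < k ∧ k < K ∧ l < k then L k * h (n + k) ^ 3 / 2 else 0)
    (O : Finset ℕ) {wO : ℕ → ℕ → ℝ} (hwO : ∀ k m, wO k m = if k ∈ O then L k * h (m + k) ^ 3 / 2 else 0)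
    {KO : ℕ → ℕ → ℝ} (hKO : ∀ m l, KO m l = ∑ k ∈ Ico (l + 1) K, wO k m)
    {RO Ry SO Sy : (ℕ → ℝ) → ℕ → ℝ}
    (hRO : ∀ u m, RO u m = ∑ l ∈ range N, KO m l * u (m + 1 + l)) (hRy : ∀ u m, Ry u m = ∑ l ∈ range N, KL y m l * u (m + 1 + l))
    (hSO : ∀ w : ℕ → ℝ, (∀ n, N < n → w n = 0) → (∀ n, N < n → SO w n = 0) ∧ ∀ n, SO w n = w n - RO (SO w) n)
    (hSy : ∀ w : ℕ → ℝ, (∀ n, N < n → w n = 0) → (∀ n, N < n → Sy w n = 0) ∧ ∀ n, Sy w n = w n - Ry (Sy w) n)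
    (hENDO : ∀ J n, J ≤ N → 0 ≤ SO (fun m => if m ≤ J then (1 : ℝ) else 0) n ∧ SO (fun m => if m ≤ J then (1 : ℝ) else 0) n ≤ 1)
    {J : ℕ} (hJ : J ≤ N) (n D : ℕ)
    {ε : ℕ → ℝ} (hεt : ∀ m, N < m → ε m = 0)
    (hεrec : ∀ m, ε m = (fun m => if m ≤ J then (1 : ℝ) else 0) m - RO ε m - Ry ε m) (hε01 : ∀ m, n < m → 0 ≤ ε m ∧ ε m ≤ 1) :
    (1 - (y : ℝ) * (L y * h (n + y) ^ 3 / 2)) * SO (fun m => if m ≤ J then (1 : ℝ) else 0) n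
      - (y : ℝ) * (L y * h (n + y) ^ 3 / 2) * ∑ m ∈ Ico n (n + D * y),
          max (SO (fun m => if m ≤ J then (1 : ℝ) else 0) (m + 1) - SO (fun m => if m ≤ J then (1 : ℝ) else 0) m) 0
      - ((y : ℝ) * (L y * h (n + y) ^ 3 / 2)) ^ D * (SO (fun m => if m ≤ J then (1 : ℝ) else 0) (n + D * y)
          + ∑ m ∈ Ico (n + D * y) (N + 1), |SO (fun m => if m ≤ J then (1 : ℝ) else 0) m - SO (fun m => if m ≤ J then (1 : ℝ) else 0) (m + 1)|)
      - 4 * (∑ k ∈ Ico 1 K, wO k n) * ((y : ℝ) * L y * h (n + y) / b) / (1 - (y : ℝ) * (L y * h (n + y) ^ 3 / 2))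
      ≤ ε n := by
  set e : ℕ → ℝ := fun m => if m ≤ J then (1 : ℝ) else 0 with he_def
  set xt : ℝ := (y : ℝ) * (L y * h (n + y) ^ 3 / 2) with hxt
  have het : ∀ m, N < m → e m = 0 := fun m hm => if_neg (show ¬ m ≤ J by omega)
  obtain ⟨hKy0, hsupp, hrow, hcap⟩ := young_kernel_facts hmono hL hb hlo hdom hh hf hy hyK hKL N
  obtain ⟨hwO0, hwOmono⟩ := old_kernel_facts hL hb hlo hh hf O hwO
  have hs2 : Real.sqrt 2 / 2 < 1 := by
    have : Real.sqrt 2 < 2 := by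
      rw [show (2 : ℝ) = Real.sqrt (2 ^ 2) by rw [Real.sqrt_sq (by norm_num)]]
      exact Real.sqrt_lt_sqrt (by norm_num) (by norm_num)
    linarith
  have hxt1 : xt < 1 := lt_of_le_of_lt (hcap n) hs2
  have hxt0 : 0 ≤ xt := by have := hL y; have := (hh (n + y)).1; positivity
  have hanti := (strictAnti_of_memFlow hb hlo hh hf).antitone
  -- young rows below the pin are ≤ xt
  have hrown : ∀ m, n ≤ m → ∑ l ∈ range N, KL y m l ≤ xt := fun m hm => by
    refine (hrow m).trans (mul_le_mul_of_nonneg_left ?_ (Nat.cast_nonneg y))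
    have h1 : h (m + y) ≤ h (n + y) := hanti (by omega)
    have h2 : h (m + y) ^ 3 ≤ h (n + y) ^ 3 := pow_le_pow_left₀ (le_of_lt (hh (m + y)).1) h1 3
    have := hL y
    have : L y * h (m + y) ^ 3 ≤ L y * h (n + y) ^ 3 := mul_le_mul_of_nonneg_left h2 this
    linarith
  -- (E115c): ε n ≥ T_0 n − Var_{≥n}(RO (Ry ε)) ∕ (1 − xt)
  have h1 := sol_ge_first_sub_var hRO hRy hKy0 hSO hSy hENDO hrown hxt1 het hεt hεrec
  -- the young reads cut at the pin: non-negative, and RO reads only below the row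
  set r' : ℕ → ℝ := fun c => if n < c then Ry ε c else 0 with hr'
  have hr'0 : ∀ c, 0 ≤ r' c := fun c => by
    simp only [hr']; split_ifs with hc
    · rw [hRy]; exact sum_nonneg fun l _ => mul_nonneg (hKy0 c l) (hε01 (c + 1 + l) (by omega)).1
    · exact le_rfl
  have hr't : ∀ c, N < c → r' c = 0 := fun c hc => by
    simp only [hr']; split_ifs
    · rw [hRy]; exact sum_eq_zero fun l _ => by rw [hεt (c + 1 + l) (by omega), mul_zero]
    · rfl
  have hROeq : ∀ m, n ≤ m → RO (Ry ε) m = RO r' m := fun m hm => by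
    rw [hRO, hRO]; exact sum_congr rfl fun l _ => by simp only [hr', if_pos (show n < m + 1 + l by omega)]
  have hVar : ∑ J' ∈ Ico n (N + 1), |RO (Ry ε) J' - RO (Ry ε) (J' + 1)| ≤ 4 * (∑ k ∈ Ico 1 K, wO k n) * ∑ c ∈ Ico (n + 1) (N + 1), r' c := by
    have h2 := var_read_le hRO hKO hwO0 hwOmono hr'0 hr't n
    refine le_trans (le_of_eq (sum_congr rfl fun m hm => ?_)) h2
    have := (mem_Ico.mp hm).1
    rw [hROeq m this, hROeq (m + 1) (by omega)]
  -- the young reads' mass below the pin ≤ the young total mass ≤ y·L_y·h(n+y)∕b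
  have hreads : ∑ c ∈ Ico (n + 1) (N + 1), r' c ≤ (y : ℝ) * L y * h (n + y) / b := by
    have hrc : ∀ c ∈ Ico (n + 1) (N + 1), r' c ≤ (y : ℝ) * (L y * h (c + y) ^ 3 / 2) := by
      intro c hc
      have hnc : n < c := by have := (mem_Ico.mp hc).1; omega
      simp only [hr', if_pos hnc]
      rw [hRy]
      calc ∑ l ∈ range N, KL y c l * ε (c + 1 + l) ≤ ∑ l ∈ range N, KL y c l :=
            sum_le_sum fun l _ => by
              have := mul_le_mul_of_nonneg_left (hε01 (c + 1 + l) (by omega)).2 (hKy0 c l); linarith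
        _ ≤ (y : ℝ) * (L y * h (c + y) ^ 3 / 2) := hrow c
    exact (sum_le_sum hrc).trans (young_total_mass_le hL hb hlo hh hf y n (N + 1))
  -- the first term by (E115b §0) `sol_ge_local'` with the floor u = 1 − xt
  have hENDy : ∀ J' m, J' ≤ N → 0 ≤ Sy (fun m => if m ≤ J' then (1 : ℝ) else 0) m ∧ Sy (fun m => if m ≤ J' then (1 : ℝ) else 0) m ≤ 1 :=
    fun J' m hJ' => let h3 := young_indicator_sol_bounds hmono hL hb hlo hdom hh hf hy hyK hKL hRy hSy hJ' m; ⟨h3.1, h3.2.1⟩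
  have hv0 : ∀ m, 0 ≤ SO e m := fun m => (hENDO J m hJ).1
  have h3 := sol_ge_local' hRy hSy hKy0 hrown hxt1.le hy hsupp hENDy (hSO e het).1 hv0 (n := n) (D := D) (u := 1 - xt)
    (by linarith) (by linarith) (fun J' hnJ' hJ'N => (young_indicator_sol_bounds hmono hL hb hlo hdom hh hf hy hyK hKL hRy hSy hJ'N n).2.2 hnJ')
  have e13 : 1 - (1 - xt) = xt := by ring
  rw [e13] at h3
  -- combine
  have hF0 : 0 ≤ ∑ k ∈ Ico 1 K, wO k n := sum_nonneg fun k _ => hwO0 k n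
  have h4 : (∑ J' ∈ Ico n (N + 1), |RO (Ry ε) J' - RO (Ry ε) (J' + 1)|) / (1 - xt)
      ≤ 4 * (∑ k ∈ Ico 1 K, wO k n) * ((y : ℝ) * L y * h (n + y) / b) / (1 - xt) := by
    refine div_le_div_of_nonneg_right (hVar.trans ?_) (by linarith)
    exact mul_le_mul_of_nonneg_left hreads (by positivity)
  linarith

end Summit.QuantumFields.BalabanUV.Beta.EriceRemainderEnclosureHistoryAutonomyComparisonAgeCompositionYoungMass

end
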